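import Literature.Topology.FourManifolds.FibrewiseInverseEstimate
import Literature.Topology.FourManifolds.SurgeryRegularDomain
import Literature.Topology.FourManifolds.RegularNeighbourhoodPrelim
import HarnessLib

/-!
# The clamped squared fibre distance of a tube: a smooth function on the middle level with
# the core sphere as zero set and no critical points near it

Topic `Literature/Topology/FourManifolds` (fact seat
`provefact-Literature.Topology.FourManifolds.Matvey-69322e0896`, rung (H4)
`Literature.Topology.FourManifolds.Matveyev1996_partOne_and_fact_of_dualSpheres` of
`CorkDecompositionMiddleLevel.lean`).  Second step of the construction of the regular
neighbourhood `V₀ = Nd_N(S_* ∪ P_*)` of the middle-level configuration (Matveyev 1996,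
arXiv:dg-ga/9505001, p. 1; Kirby 1996, arXiv:math/9712231, §3) as a regular sublevel set:
from a *modified fibre coordinate* `F` of the `i`-th tube `φᵢ : Sᵃ × ℝᵇ → N` of a framed
family (`ModifiedFibreCoordinate.lean`: smooth on the tube, zero on the core sphere, fibre
derivative the identity along it) we build a smooth function `H : N → ℝ` on the whole middle
level which is the squared modified fibre distance `‖F‖²` near the core sphere, has the core
sphere as its zero set, has no critical points on the levels `0 < H < τ`, and is the constant
`τ` off the tube.  The analysis is the fibrewise inverse-function estimate of the tubular
neighbourhood theorem (Hirsch, *Differential Topology* (1976), Ch. 4 §5, proof of Thm. 5.1;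
`FibrewiseInverseEstimate.lean`), read in the charts of the sphere; the clamping is the level
cutoff of `SurgeryRegularDomain.lean` and the extension by a constant of
`RegularNeighbourhoodPrelim.lean`.  Everything is proved; no definitions, no named facts:

* `Literature.Topology.FourManifolds.levelCutoff_le_neg` — below `-δ` the level cutoff is
  `≤ -δ`;
* `Literature.Topology.FourManifolds.FramedSphereFamily.exists_thinTube_of_hasFDerivAt_id` —
  **the thin tube**: there is `δ₁ > 0` such that for `0 < ‖w‖ ≤ δ₁` the modified fibre
  coordinate does not vanish at `φᵢ(x, w)` and the squared modified fibre distance `‖F‖²`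
  has no critical point there (continuity of the fibre derivative, which is the identity
  along the zero section, the tube lemma over the compact sphere, and the fibrewise
  estimates `apply_ne_zero_of_fderiv_fibre`, `fderiv_norm_sq_fibre_ne_zero`);
* `Literature.Topology.FourManifolds.FramedSphereFamily.exists_clampedFibreDistance` — **the
  clamped squared fibre distance**: a threshold `τ₀ > 0` such that for every `0 < τ ≤ τ₀`
  there is a `C^∞` function `H : N → ℝ`, `0 ≤ H`, equal to `τ` off the tube `φᵢ(Sᵃ × ℝᵇ)`,
  with zero set exactly the core sphere `Sᵢ`, equal to `‖F‖²` near every point where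
  `H < τ`, and without critical points where `0 < H < τ`.

## References

* R. Matveyev, *A decomposition of smooth simply-connected h-cobordant 4-manifolds*,
  J. Differential Geom. 44 (1996) 571–582; arXiv:dg-ga/9505001, Proof of Theorem, p. 1.
  [Matveyev1996]
* R. Kirby, *Akbulut's corks and h-cobordisms of smooth, simply connected 4-manifolds*, Turkish
  J. Math. 20 (1996) 85–93; arXiv:math/9712231, §3. [KirbyCorks1996]
* M. W. Hirsch, *Differential Topology*, GTM 33 (1976), Ch. 4 §5, Thm. 5.1 and its proof.
  [HirschDT1976]
* J. Milnor, *Lectures on the h-cobordism theorem*, Princeton (1965), Def. 3.9 (PDF p. 16).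
  [MilnorHCobordism1965]
-/

open scoped Manifold ContDiff Topology
open Set Function Filter Metric

noncomputable section

namespace Literature.Topology.FourManifolds

universe u v

/-! ### One more property of the level cutoff -/

/-- Below `-δ` the level cutoff is at most `-δ`. [folklore] -/
theorem levelCutoff_le_neg {δ t : ℝ} (ht : t ≤ -δ) : levelCutoff δ t ≤ -δ := by
  have h1 : Real.smoothTransition ((t + 2 * δ) / δ) * (t + δ) ≤ 0 :=
    mul_nonpos_of_nonneg_of_nonpos (Real.smoothTransition.nonneg _) (by linarith)
  rw [levelCutoff]
  linarith

namespace FramedSphereFamily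

variable {n a b : ℕ} {N : Type u} [TopologicalSpace N] [T2Space N]
  [ChartedSpace (EuclideanSpace ℝ (Fin n)) N] {ι : Type v}

/-! ### The thin tube -/

omit [T2Space N] in
/-- **The thin tube about a core sphere, for a modified fibre coordinate.**  Let
`φᵢ : Sᵃ × ℝᵇ → N` be the `i`-th tube of a framed family and `F : N → ℝᵇ` a map which is
`C^∞` on the tube, vanishes on the core sphere and has fibre derivative the identity along
it (`d(w ↦ F(φᵢ(x, w)))_0 = id`; `FramedSphereFamily.exists_modifiedFibreCoordinate`).  Then
there is `δ₁ > 0` such that for every `x` and every `0 < ‖w‖ ≤ δ₁`: `F(φᵢ(x, w)) ≠ 0`, and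
`φᵢ(x, w)` is not a critical point of `‖F‖²`.  Proof: the fibre derivative
`(x, w) ↦ d(F ∘ φᵢ(x, ·))_w` is continuous (read in a chart of the sphere it is
`dG̃ ∘ inr` for the jointly smooth `G̃`), equal to `id` on the zero section, so it is
`½`-close to `id` on a uniform thin tube (tube lemma over the compact sphere); there the
fibrewise estimates of the tubular neighbourhood theorem apply
(`apply_ne_zero_of_fderiv_fibre`, `fderiv_norm_sq_fibre_ne_zero`; Hirsch 1976, Ch. 4 §5),
and a critical point of `‖F‖²` on `N` would be one of its restriction to the fibre.
[cite: HirschDT1976, Ch. 4 §5, proof of Thm. 5.1] [cite: MilnorHCobordism1965, Def. 3.9 (PDF p. 16)] -/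
theorem exists_thinTube_of_hasFDerivAt_id (S : FramedSphereFamily (𝓡 n) N ι a b) (i : ι)
    {F : N → EuclideanSpace ℝ (Fin b)}
    (hF : ContMDiffOn (𝓡 n) 𝓘(ℝ, EuclideanSpace ℝ (Fin b)) ∞ F (range (S.toFun i)))
    (hF0 : ∀ x, F (S.sphere i x) = 0)
    (hFd : ∀ x, HasFDerivAt (fun w : EuclideanSpace ℝ (Fin b) => F (S.toFun i (x, w)))
      (ContinuousLinearMap.id ℝ (EuclideanSpace ℝ (Fin b))) 0) :
    ∃ δ₁ : ℝ, 0 < δ₁ ∧ ∀ x (w : EuclideanSpace ℝ (Fin b)), ‖w‖ ≤ δ₁ → w ≠ 0 →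
      F (S.toFun i (x, w)) ≠ 0 ∧
      ¬ IsMCriticalPt (𝓡 n) (fun z => ‖F z‖ ^ 2) (S.toFun i (x, w)) := by
  -- the tube map read on `Sᵃ × ℝᵇ`, and its fibre derivative
  set Φ : Metric.sphere (0 : EuclideanSpace ℝ (Fin (a + 1))) 1 × EuclideanSpace ℝ (Fin b) →
      EuclideanSpace ℝ (Fin b) := fun q => F (S.toFun i q) with hΦ_def
  have hΦ : ContMDiff ((𝓡 a).prod (𝓡 b)) 𝓘(ℝ, EuclideanSpace ℝ (Fin b)) ∞ Φ :=
    hF.comp_contMDiff (S.contMDiff i) fun q => mem_range_self q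
  set D : Metric.sphere (0 : EuclideanSpace ℝ (Fin (a + 1))) 1 × EuclideanSpace ℝ (Fin b) →
      EuclideanSpace ℝ (Fin b) →L[ℝ] EuclideanSpace ℝ (Fin b) :=
    fun q => fderiv ℝ (fun w => Φ (q.1, w)) q.2 with hD_def
  have hfst : ContMDiff 𝓘(ℝ, EuclideanSpace ℝ (Fin a) × EuclideanSpace ℝ (Fin b))
      𝓘(ℝ, EuclideanSpace ℝ (Fin a)) ∞
      (Prod.fst : EuclideanSpace ℝ (Fin a) × EuclideanSpace ℝ (Fin b) → EuclideanSpace ℝ (Fin a)) :=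
    (ContinuousLinearMap.fst ℝ (EuclideanSpace ℝ (Fin a)) (EuclideanSpace ℝ (Fin b))).contMDiff
  have hsnd : ContMDiff 𝓘(ℝ, EuclideanSpace ℝ (Fin a) × EuclideanSpace ℝ (Fin b))
      𝓘(ℝ, EuclideanSpace ℝ (Fin b)) ∞
      (Prod.snd : EuclideanSpace ℝ (Fin a) × EuclideanSpace ℝ (Fin b) → EuclideanSpace ℝ (Fin b)) :=
    (ContinuousLinearMap.snd ℝ (EuclideanSpace ℝ (Fin a)) (EuclideanSpace ℝ (Fin b))).contMDiff
  -- in the chart of the sphere at `x₀`: the jointly smooth `G̃ (y, w) = Φ (φ⁻¹ y, w)`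
  have hchart : ∀ x₀ : Metric.sphere (0 : EuclideanSpace ℝ (Fin (a + 1))) 1,
      ∃ G : EuclideanSpace ℝ (Fin a) × EuclideanSpace ℝ (Fin b) → EuclideanSpace ℝ (Fin b),
        ContDiffOn ℝ ∞ G ((chartAt (EuclideanSpace ℝ (Fin a)) x₀).target ×ˢ univ) ∧
        ∀ x ∈ (chartAt (EuclideanSpace ℝ (Fin a)) x₀).source, ∀ w,
          G (chartAt (EuclideanSpace ℝ (Fin a)) x₀ x, w) = Φ (x, w) := by
    intro x₀
    set φ := chartAt (EuclideanSpace ℝ (Fin a)) x₀ with hφ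
    refine ⟨fun p => Φ (φ.symm p.1, p.2), ?_, fun x hx w => by simp only [φ.left_inv hx]⟩
    have h1 : ContMDiffOn 𝓘(ℝ, EuclideanSpace ℝ (Fin a)) (𝓡 a) ∞ φ.symm φ.target :=
      contMDiffOn_chart_symm (I := 𝓡 a) (x := x₀)
    have h2 : ContMDiffOn 𝓘(ℝ, EuclideanSpace ℝ (Fin a) × EuclideanSpace ℝ (Fin b))
        ((𝓡 a).prod (𝓡 b)) ∞
        (fun p : EuclideanSpace ℝ (Fin a) × EuclideanSpace ℝ (Fin b) =>
          ((φ.symm p.1, p.2) :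
            Metric.sphere (0 : EuclideanSpace ℝ (Fin (a + 1))) 1 × EuclideanSpace ℝ (Fin b)))
        (φ.target ×ˢ univ) :=
      (h1.comp hfst.contMDiffOn fun p hp => hp.1).prodMk hsnd.contMDiffOn
    exact contMDiffOn_iff_contDiffOn.1 (hΦ.comp_contMDiffOn h2)
  -- continuity of the fibre derivative
  have hDc : Continuous D := by
    rw [continuous_iff_continuousAt]
    rintro ⟨x₀, w₀⟩
    obtain ⟨G, hG, hGΦ⟩ := hchart x₀
    set φ := chartAt (EuclideanSpace ℝ (Fin a)) x₀ with hφ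
    have hO : IsOpen (φ.target ×ˢ (univ : Set (EuclideanSpace ℝ (Fin b)))) :=
      φ.open_target.prod isOpen_univ
    have hsrc : IsOpen (φ.source ×ˢ (univ : Set (EuclideanSpace ℝ (Fin b)))) :=
      φ.open_source.prod isOpen_univ
    have hmem₀ : (x₀, w₀) ∈ φ.source ×ˢ (univ : Set (EuclideanSpace ℝ (Fin b))) :=
      ⟨mem_chart_source _ x₀, mem_univ _⟩
    have hGd : ∀ p ∈ φ.target ×ˢ (univ : Set (EuclideanSpace ℝ (Fin b))),
        DifferentiableAt ℝ G p := fun p hp =>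
      (hG.differentiableOn (by simp) p hp).differentiableAt (hO.mem_nhds hp)
    -- on `φ.source × ℝᵇ`, `D = dG̃ ∘ inr`
    have heq : ∀ q ∈ φ.source ×ˢ (univ : Set (EuclideanSpace ℝ (Fin b))),
        D q = (fderiv ℝ G (φ q.1, q.2)).comp
          (ContinuousLinearMap.inr ℝ (EuclideanSpace ℝ (Fin a)) (EuclideanSpace ℝ (Fin b))) := by
      rintro ⟨x, w⟩ ⟨hx, -⟩
      have hfun : (fun w' => Φ (x, w')) = fun w' => G (φ x, w') :=
        funext fun w' => (hGΦ x hx w').symm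
      show fderiv ℝ (fun w' => Φ (x, w')) w = _
      rw [hfun]
      exact fderiv_fibre_eq_comp_inr (p := (φ x, w)) (hGd _ ⟨φ.map_source hx, mem_univ _⟩)
    have hc1 : ContinuousOn (fderiv ℝ G) (φ.target ×ˢ univ) :=
      hG.continuousOn_fderiv_of_isOpen hO (by simp)
    have hc2 : ContinuousOn
        (fun q : Metric.sphere (0 : EuclideanSpace ℝ (Fin (a + 1))) 1 × EuclideanSpace ℝ (Fin b) =>
          (φ q.1, q.2)) (φ.source ×ˢ univ) :=
      (φ.continuousOn.comp continuous_fst.continuousOn fun q hq => hq.1).prodMk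
        continuous_snd.continuousOn
    have hc3 : ContinuousOn
        (fun q : Metric.sphere (0 : EuclideanSpace ℝ (Fin (a + 1))) 1 × EuclideanSpace ℝ (Fin b) =>
          (fderiv ℝ G (φ q.1, q.2)).comp
            (ContinuousLinearMap.inr ℝ (EuclideanSpace ℝ (Fin a)) (EuclideanSpace ℝ (Fin b))))
        (φ.source ×ˢ univ) := by
      have h := hc1.comp hc2 fun q hq => ⟨φ.map_source hq.1, mem_univ _⟩
      exact isBoundedBilinearMap_comp.continuous.comp_continuousOn (h.prodMk continuousOn_const)
    have hat := hc3.continuousAt (hsrc.mem_nhds hmem₀)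
    refine hat.congr ?_
    filter_upwards [hsrc.mem_nhds hmem₀] with q hq
    exact (heq q hq).symm
  -- the fibre derivative is the identity on the zero section; the thin tube
  have hD0 : ∀ x, D (x, 0) = ContinuousLinearMap.id ℝ (EuclideanSpace ℝ (Fin b)) :=
    fun x => (hFd x).fderiv
  set A : Set (Metric.sphere (0 : EuclideanSpace ℝ (Fin (a + 1))) 1 × EuclideanSpace ℝ (Fin b)) :=
    D ⁻¹' ball (ContinuousLinearMap.id ℝ (EuclideanSpace ℝ (Fin b))) (1 / 2) with hA_def
  have hA : IsOpen A := isOpen_ball.preimage hDc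
  have hsub : (univ : Set (Metric.sphere (0 : EuclideanSpace ℝ (Fin (a + 1))) 1)) ×ˢ
      ({0} : Set (EuclideanSpace ℝ (Fin b))) ⊆ A := by
    rintro ⟨x, w⟩ ⟨-, hw⟩
    rw [mem_singleton_iff] at hw
    subst hw
    show D (x, 0) ∈ ball _ _
    rw [hD0]
    exact mem_ball_self (by norm_num)
  obtain ⟨u, t, -, ht, huniv, h0t, hut⟩ :=
    generalized_tube_lemma isCompact_univ isCompact_singleton hA hsub
  obtain ⟨ε, hε, hball⟩ := Metric.isOpen_iff.1 ht 0 (h0t (mem_singleton _))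
  have hle : ∀ x (w' : EuclideanSpace ℝ (Fin b)), ‖w'‖ ≤ ε / 2 →
      ‖D (x, w') - ContinuousLinearMap.id ℝ (EuclideanSpace ℝ (Fin b))‖ ≤ 1 / 2 := by
    intro x w' hw'
    have hmem : (x, w') ∈ A :=
      hut ⟨huniv (mem_univ x), hball (by rw [mem_ball, dist_zero_right]; linarith)⟩
    rw [hA_def, mem_preimage, mem_ball, dist_eq_norm] at hmem
    exact hmem.le
  refine ⟨ε / 2, half_pos hε, fun x w hw hw0 => ?_⟩
  -- through the chart of the sphere at `x`, the fibrewise estimates apply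
  obtain ⟨G, hG, hGΦ⟩ := hchart x
  set φ := chartAt (EuclideanSpace ℝ (Fin a)) x with hφ
  have hxs : x ∈ φ.source := mem_chart_source _ x
  have hO : IsOpen (φ.target ×ˢ (univ : Set (EuclideanSpace ℝ (Fin b)))) :=
    φ.open_target.prod isOpen_univ
  have hG1 : ContDiffOn ℝ 1 G (φ.target ×ˢ univ) := hG.of_le (by simp)
  have hmemΩ : ∀ w' : EuclideanSpace ℝ (Fin b), ‖w'‖ ≤ ε / 2 →
      (φ x, w') ∈ φ.target ×ˢ (univ : Set (EuclideanSpace ℝ (Fin b))) :=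
    fun w' _ => ⟨φ.map_source hxs, mem_univ _⟩
  have hfunx : (fun w' => G (φ x, w')) = fun w' => Φ (x, w') :=
    funext fun w' => hGΦ x hxs w'
  have hle' : ∀ w' : EuclideanSpace ℝ (Fin b), ‖w'‖ ≤ ε / 2 →
      ‖fderiv ℝ (fun w'' => G (φ x, w'')) w' -
        ContinuousLinearMap.id ℝ (EuclideanSpace ℝ (Fin b))‖ ≤ 1 / 2 := fun w' hw' => by
    rw [hfunx]
    exact hle x w' hw'
  have h0 : G (φ x, 0) = 0 := by
    rw [hGΦ x hxs]
    exact hF0 x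
  have hne : G (φ x, w) ≠ 0 := apply_ne_zero_of_fderiv_fibre hO hG1 hmemΩ hle' h0 hw hw0
  have hneF : F (S.toFun i (x, w)) ≠ 0 := by
    rw [hGΦ x hxs] at hne
    exact hne
  refine ⟨hneF, fun hc => ?_⟩
  -- the derivative of the squared fibre distance along the fibre does not vanish
  have hd : DifferentiableAt ℝ (fun w' => G (φ x, w')) w :=
    ((hG.differentiableOn (by simp) _ (hmemΩ w hw)).differentiableAt
      (hO.mem_nhds (hmemΩ w hw))).comp w
      ((differentiableAt_const _).prodMk differentiableAt_id)
  have hsq := fderiv_norm_sq_fibre_ne_zero hd (hle' w hw) hne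
  have hfunsq : (fun w' => ‖G (φ x, w')‖ ^ 2) =
      fun w' : EuclideanSpace ℝ (Fin b) => ‖F (S.toFun i (x, w'))‖ ^ 2 :=
    funext fun w' => by rw [hGΦ x hxs w']
  rw [hfunsq] at hsq
  -- … while a critical point on `N` would give a critical point along the fibre
  have hj : MDifferentiableAt 𝓘(ℝ, EuclideanSpace ℝ (Fin b)) (𝓡 n)
      (fun w' : EuclideanSpace ℝ (Fin b) => S.toFun i (x, w')) w :=
    ((S.contMDiff i).comp (contMDiff_const.prodMk contMDiff_id)).mdifferentiableAt (by simp)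
  have hh : MDifferentiableAt (𝓡 n) 𝓘(ℝ, ℝ) (fun z => ‖F z‖ ^ 2) (S.toFun i (x, w)) := by
    have h1 : ContMDiffAt (𝓡 n) 𝓘(ℝ, EuclideanSpace ℝ (Fin b)) ∞ F (S.toFun i (x, w)) :=
      (hF _ (mem_range_self _)).contMDiffAt ((S.isOpen_range i).mem_nhds (mem_range_self _))
    have h2 : ContMDiffAt (𝓡 n) 𝓘(ℝ, ℝ) ∞ (fun z => ‖F z‖ ^ 2) (S.toFun i (x, w)) :=
      ((contDiff_norm_sq ℝ (n := ∞)).contMDiff.contMDiffAt).comp _ h1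
    exact h2.mdifferentiableAt (by simp)
  have hcomp := IsMCriticalPt.comp (j := fun w' : EuclideanSpace ℝ (Fin b) => S.toFun i (x, w'))
    (a := w) hc hh hj
  unfold IsMCriticalPt at hcomp
  rw [mfderiv_eq_fderiv] at hcomp
  exact hsq hcomp

/-! ### The clamped squared fibre distance -/

/-- **The clamped squared fibre distance of a tube** (the function presenting the tube about
one sphere of the configuration as a regular neighbourhood; Matveyev 1996, p. 1,
`Nd_N(S_*)`; Kirby 1996, §3).  Let `φᵢ : Sᵃ × ℝᵇ → N` be the `i`-th tube of a framed family
in the Hausdorff manifold `N` and `F : N → ℝᵇ` a modified fibre coordinate (smooth on the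
tube, zero on the core sphere, fibre derivative the identity along it;
`FramedSphereFamily.exists_modifiedFibreCoordinate`).  Then there is a threshold `τ₀ > 0`
such that for every `0 < τ ≤ τ₀` there is a `C^∞` function `H : N → ℝ` with: `0 ≤ H`;
`H = τ` off the tube `φᵢ(Sᵃ × ℝᵇ)`; `H z = 0 ↔ z ∈ Sᵢ`; near every point where `H < τ`, `H`
is the squared modified fibre distance `‖F‖²`; and `H` has no critical point where
`0 < H < τ`.  Construction: with the thin tube `‖w‖ ≤ δ₁` of
`FramedSphereFamily.exists_thinTube_of_hasFDerivAt_id`, let `2τ₀` be the minimum of `‖F‖²`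
on the compact shell `δ₁/2 ≤ ‖w‖ ≤ δ₁` (positive, as `F ≠ 0` there); on the open `δ₁`-tube
put `H = -levelCutoff τ (-‖F‖²)` (equal to `‖F‖²` where that is `≤ τ`, to `τ` where it is
`≥ 2τ`, in particular near the edge of the tube), and `H = τ` elsewhere
(`contMDiff_piecewise_const_of_eqOn`).
[cite: Matveyev1996, Proof of Theorem (arXiv p. 1)] [cite: KirbyCorks1996, §3]
[cite: HirschDT1976, Ch. 4 §5, proof of Thm. 5.1] -/
theorem exists_clampedFibreDistance (S : FramedSphereFamily (𝓡 n) N ι a b) (i : ι)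
    {F : N → EuclideanSpace ℝ (Fin b)}
    (hF : ContMDiffOn (𝓡 n) 𝓘(ℝ, EuclideanSpace ℝ (Fin b)) ∞ F (range (S.toFun i)))
    (hF0 : ∀ x, F (S.sphere i x) = 0)
    (hFd : ∀ x, HasFDerivAt (fun w : EuclideanSpace ℝ (Fin b) => F (S.toFun i (x, w)))
      (ContinuousLinearMap.id ℝ (EuclideanSpace ℝ (Fin b))) 0) :
    ∃ τ₀ : ℝ, 0 < τ₀ ∧ ∀ τ : ℝ, 0 < τ → τ ≤ τ₀ →
      ∃ H : N → ℝ, ContMDiff (𝓡 n) 𝓘(ℝ, ℝ) ∞ H ∧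
        (∀ z, 0 ≤ H z) ∧
        (∀ z, z ∉ range (S.toFun i) → H z = τ) ∧
        (∀ z, H z = 0 ↔ z ∈ range (S.sphere i)) ∧
        (∀ z, H z < τ → H =ᶠ[𝓝 z] fun z => ‖F z‖ ^ 2) ∧
        (∀ z, 0 < H z → H z < τ → ¬ IsMCriticalPt (𝓡 n) H z) := by
  classical
  obtain ⟨δ₁, hδ₁, hthin⟩ := S.exists_thinTube_of_hasFDerivAt_id i hF hF0 hFd
  -- the squared modified fibre distance `h = ‖F‖²`, smooth on the tube
  set h : N → ℝ := fun z => ‖F z‖ ^ 2 with hh_def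
  have hhs : ContMDiffOn (𝓡 n) 𝓘(ℝ, ℝ) ∞ h (range (S.toFun i)) :=
    ((contDiff_norm_sq ℝ (n := ∞)).contMDiff).comp_contMDiffOn hF
  have hh0 : ∀ x (w : EuclideanSpace ℝ (Fin b)), ‖w‖ ≤ δ₁ → (h (S.toFun i (x, w)) = 0 ↔ w = 0) := by
    intro x w hw
    constructor
    · intro h0
      by_contra hw0
      exact (hthin x w hw hw0).1 (by simpa [hh_def] using h0)
    · rintro rfl
      show ‖F (S.toFun i (x, 0))‖ ^ 2 = 0
      rw [← S.sphere_apply, hF0 x]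
      simp
  -- the open `δ₁`-tube `U`, the closed `δ₁/2`-tube `K`, the shell `Q`
  set U : Set N := (S.toFun i) '' (univ ×ˢ ball (0 : EuclideanSpace ℝ (Fin b)) δ₁) with hU_def
  set K : Set N := (S.toFun i) '' (univ ×ˢ closedBall (0 : EuclideanSpace ℝ (Fin b)) (δ₁ / 2))
    with hK_def
  have hopen : Topology.IsOpenEmbedding (S.toFun i) :=
    ⟨(S.isSmoothEmbedding i).isEmbedding, S.isOpen_range i⟩
  have hU : IsOpen U := hopen.isOpenMap _ (isOpen_univ.prod isOpen_ball)
  have hK : IsClosed K :=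
    ((isCompact_univ.prod (isCompact_closedBall _ _)).image (S.continuous i)).isClosed
  have hKU : K ⊆ U := by
    rintro _ ⟨⟨x, w⟩, ⟨-, hw⟩, rfl⟩
    refine ⟨(x, w), ⟨mem_univ _, ?_⟩, rfl⟩
    rw [mem_closedBall, dist_zero_right] at hw
    rw [mem_ball, dist_zero_right]
    linarith
  have hUsub : U ⊆ range (S.toFun i) := by
    rintro _ ⟨q, -, rfl⟩
    exact mem_range_self q
  have hsphU : ∀ x, S.sphere i x ∈ U := fun x =>
    ⟨(x, 0), ⟨mem_univ _, by rw [mem_ball, dist_self]; exact hδ₁⟩, (S.sphere_apply i x).symm⟩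
  have hmemU : ∀ {z}, z ∈ U → ∃ x w, ‖w‖ < δ₁ ∧ S.toFun i (x, w) = z := by
    rintro _ ⟨⟨x, w⟩, ⟨-, hw⟩, rfl⟩
    exact ⟨x, w, mem_ball_zero_iff.1 hw, rfl⟩
  -- the minimum `m > 0` of `h` on the shell
  set Q : Set (Metric.sphere (0 : EuclideanSpace ℝ (Fin (a + 1))) 1 × EuclideanSpace ℝ (Fin b)) :=
    univ ×ˢ (closedBall (0 : EuclideanSpace ℝ (Fin b)) δ₁ \ ball 0 (δ₁ / 2)) with hQ_def
  have hQc : IsCompact Q := isCompact_univ.prod ((isCompact_closedBall _ _).diff isOpen_ball)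
  have hQpos : ∀ q ∈ Q, 0 < h (S.toFun i q) := by
    rintro ⟨x, w⟩ ⟨-, hw, hw'⟩
    rw [mem_closedBall, dist_zero_right] at hw
    rw [mem_ball, dist_zero_right, not_lt] at hw'
    have hw0 : w ≠ 0 := fun h0 => by
      rw [h0, norm_zero] at hw'
      linarith
    have := (hthin x w hw hw0).1
    positivity
  have hcontQ : ContinuousOn (fun q => h (S.toFun i q)) Q :=
    (hhs.continuousOn.comp (S.continuous i).continuousOn fun q _ => mem_range_self q)
  have hm : ∃ m : ℝ, 0 < m ∧ ∀ q ∈ Q, m ≤ h (S.toFun i q) := by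
    rcases Q.eq_empty_or_nonempty with hQe | hQne
    · exact ⟨1, one_pos, fun q hq => by rw [hQe] at hq; exact absurd hq (notMem_empty q)⟩
    · obtain ⟨q₀, hq₀, hmin⟩ := hQc.exists_isMinOn hQne hcontQ
      exact ⟨h (S.toFun i q₀), hQpos q₀ hq₀, fun q hq => hmin hq⟩
  obtain ⟨m, hm0, hmle⟩ := hm
  refine ⟨m / 2, half_pos hm0, fun τ hτ hτm => ?_⟩
  -- on `U ∖ K` the squared distance is `≥ 2τ`
  have hUK : ∀ z ∈ U, z ∉ K → 2 * τ ≤ h z := by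
    intro z hzU hzK
    obtain ⟨x, w, hw, rfl⟩ := hmemU hzU
    have hw' : ¬ ‖w‖ ≤ δ₁ / 2 := fun hle =>
      hzK ⟨(x, w), ⟨mem_univ _, mem_closedBall_zero_iff.2 hle⟩, rfl⟩
    have hq : (x, w) ∈ Q := ⟨mem_univ _, mem_closedBall_zero_iff.2 hw.le,
      fun hb => hw' (mem_ball_zero_iff.1 hb).le⟩
    linarith [hmle _ hq]
  -- the clamped function
  set H : N → ℝ := fun z => if z ∈ U then -levelCutoff τ (-h z) else τ with hH_def
  have hHU : ∀ z ∈ U, H z = -levelCutoff τ (-h z) := fun z hz => by simp [hH_def, hz]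
  have hHU' : ∀ z, z ∉ U → H z = τ := fun z hz => by simp [hH_def, hz]
  -- smoothness
  have hHs : ContMDiff (𝓡 n) 𝓘(ℝ, ℝ) ∞ H := by
    have hf : ContMDiffOn (𝓡 n) 𝓘(ℝ, ℝ) ∞ (fun z => -levelCutoff τ (-h z)) U :=
      (((contDiff_levelCutoff τ).contMDiff.comp_contMDiffOn (hhs.mono hUsub).neg)).neg
    have hc : ∀ z ∈ U, z ∉ K → -levelCutoff τ (-h z) = τ := fun z hzU hzK => by
      rw [levelCutoff_of_le hτ (by linarith [hUK z hzU hzK]), neg_neg]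
    exact contMDiff_piecewise_const_of_eqOn hU hK hKU hf hc
  -- where `H < τ`: inside `U`, with `h < τ`, and `H = h` nearby
  have hlt : ∀ z, H z < τ → z ∈ U ∧ h z < τ := by
    intro z hz
    have hzU : z ∈ U := by
      by_contra hzU
      rw [hHU' z hzU] at hz
      exact lt_irrefl _ hz
    refine ⟨hzU, ?_⟩
    by_contra hge
    push Not at hge
    have h1 : levelCutoff τ (-h z) ≤ -τ := levelCutoff_le_neg (by linarith)
    rw [hHU z hzU] at hz
    linarith
  have hloc : ∀ z, H z < τ → H =ᶠ[𝓝 z] h := by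
    intro z hz
    obtain ⟨hzU, hhz⟩ := hlt z hz
    have ho : IsOpen (U ∩ h ⁻¹' Iio τ) :=
      (hhs.continuousOn.mono hUsub).isOpen_inter_preimage hU isOpen_Iio
    filter_upwards [ho.mem_nhds ⟨hzU, hhz⟩] with y hy
    rw [hHU y hy.1, levelCutoff_of_neg_le hτ (by simpa using (le_of_lt hy.2)), neg_neg]
  refine ⟨H, hHs, fun z => ?_, fun z hz => hHU' z fun hzU => hz (hUsub hzU), fun z => ?_, hloc,
    fun z h0 hτ' hc => ?_⟩
  · -- `0 ≤ H`
    by_cases hz : z ∈ U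
    · rw [hHU z hz, neg_nonneg, levelCutoff_nonpos_iff hτ, neg_nonpos]
      positivity
    · rw [hHU' z hz]
      exact hτ.le
  · -- the zero set is the core sphere
    constructor
    · intro hz0
      have hzU : z ∈ U := (hlt z (by rw [hz0]; exact hτ)).1
      obtain ⟨x, w, hw, rfl⟩ := hmemU hzU
      rw [hHU _ hzU, neg_eq_zero, levelCutoff_eq_zero_iff hτ, neg_eq_zero] at hz0
      have hw0 : w = 0 := (hh0 x w hw.le).1 hz0
      exact ⟨x, by rw [S.sphere_apply, hw0]⟩
    · rintro ⟨x, rfl⟩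
      rw [hHU _ (hsphU x), neg_eq_zero, levelCutoff_eq_zero_iff hτ, neg_eq_zero, S.sphere_apply]
      exact (hh0 x 0 (by rw [norm_zero]; exact hδ₁.le)).2 rfl
  · -- no critical points where `0 < H < τ`
    obtain ⟨hzU, hhz⟩ := hlt z hτ'
    obtain ⟨x, w, hw, rfl⟩ := hmemU hzU
    have hHz : H (S.toFun i (x, w)) = h (S.toFun i (x, w)) := (hloc _ hτ').eq_of_nhds
    have hw0 : w ≠ 0 := fun hw0 => by
      rw [hHz, (hh0 x w hw.le).2 hw0] at h0
      exact lt_irrefl _ h0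
    have hreg := (hthin x w hw.le hw0).2
    apply hreg
    unfold IsMCriticalPt at hc ⊢
    rw [← (hloc _ hτ').mfderiv_eq]
    exact hc

end FramedSphereFamily

end Literature.Topology.FourManifolds

end
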